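import Summits.QuantumFields.YangMills.Theorems.BalabanUVNodesN15TwoSpacingGluingCurvedKnitCovariantAveraging
import Summits.QuantumFields.YangMills.Theorems.BalabanUVNodesN15TwoSpacingGluingCurvedKnitSmallFieldDefect
import Summits.QuantumFields.YangMills.Theorems.BalabanUVNodesN15CovariantAveragingDefect
import Summits.QuantumFields.YangMills.Theorems.BalabanUVNodesN15CovariantAveragingHolonomyLineFit
import HarnessLib

/-!
# THE GLUING STEP AT TWO LATTICE SPACINGS — PROGRAMME (P-Q), VIIa: THE COVER OBJECTS AND TRANSFER LEMMAS FOR THE TWO-GRID ROWS OF `N_V^Q` — the fine perturbation `N_V^Q′`, the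
# sandwich identities through King's prolongation (`χ′ = χ∘π̂`), the two-carrier sandwich bound, the fine-norm blocking transfer, and the transporter letters of `e^{ηA}` for a skew
# field in FILE 130's currency (rows AND columns `≤ |ι|·κ_e·2√m·√m·2r_Aη`)

Cell `pub-ymgap`, seat `pub-ymgap-dag-n15-c` (R134 (a); HUMAN RULING D-0062), generation 21.  `bears_on: R4∕N15 · K3⁸ SpineGivenEndpointR13SepCoPHV (stmt-QuantumFields-27366)`.
Filed `--supports stmt-QuantumFields-27366 --as helper` — COUNT-NEUTRAL.  One plumbing `def` (`cvNVq'`) + theorems; 0 `sorry`.  Imports BY NAME n15-c∕183 (`cvT`, `cvNVq`, `conj_one_cvNL_sub_cvNVq`,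
`hasMaj_sandwich_of_abs_le_one`; FILE 129's `conj_one_eq_sub_zero`), FILE 130 (`gavgM_conjTranspose_of_skew`), n15-c∕186 (`hasMaj_idef_nvQ`), n15-c∕185c (`norm_holPath_two_grid_le`,
`norm_exp_smul_sub_one_le`; through them 185a `rows∕cols_cvaPath_conj_sub_le`, 184a `blockOf_kingPr`), dag-n15-w2 `uN_abs_coordMat_conj_sub_one_entry_le_op`,
`CurvedSpecies.exp_smul_unitary_of_conjTranspose`, dag-n15-a `chiCube_kingPrV`.  Nothing in the tree is modified.

WHY.  FILE 123 (`uN_idef_cvGlued`) displays six rows for the nonlocal perturbation at two spacings: `hNVcut`∕`hNVcut′` (one grid, coarse∕fine), `hDNV` (`idef P̂ P̂ (ψ′N_V′χ′) (ψN_Vχ)`),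
`hfarN`∕`hfarN′`, `hDfarN`.  With Bałaban's covariant averaging summand live (n15-c∕183: `P := N_L ⊗ 1 − N_V^Q`, `N_V^Q = a(Q*Q ⊗ 1 − Q*(U)Q(U))`) these rows follow from n15-c∕182b (one grid)
and n15-c∕186 (two grids) once (i) the fine twin `N_V^Q′` is named, (ii) the cut-offs are moved outside the defect (`χ′_k = χ_k∘π̂`, `ψ′_k = ψ_k∘π̂` on the cover: dag-n15-a `chiCube_kingPrV`),
(iii) the fine norm of FILE 123 (blocks `cvBlk∘π̂`) is identified with the fine unit-block norm (`blockOf_kingPr`), and (iv) the transporters `Ad_{e^{ηA}}` of a skew field with `‖A‖ ≤ r_A`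
are `ρ`-close to `1` in rows and columns, `ρ = |ι|·κ_e·2√m·√m·(e^{ηr_A} − 1) ≤ |ι|κ_e·2m·2r_Aη`.  THIS FILE supplies (i)–(iv); the sequel writes the six rows and runs FILE 123.

WHAT.
* §1 ★ `cvNVq'` (the fine `N_V^Q′`), `conj_one_cvNL'_sub_cvNVq'` (123's `hP′` at `w ≡ 1`).
* §2 `idef_sandwich_pull` (`idef P̂ P̂ (M_{ψ∘π̂}N′M_{χ∘π̂}) (M_ψNM_χ) = M_{ψ∘π̂} ∘ idef P̂ P̂ N′ N ∘ M_χ`), `hasMaj_sandwich₂_of_abs_le_one` (two carriers), `liftBlk_blockOf_fine_eq` (blocking transfer),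
  `cvChi'_eq_comp`, `cvPsi'_eq_comp` (the cover's cut-offs factor through `π̂`).
* §3 ★ `sf_rows_cvT_exp_sub_one_le` ∕ ★ `sf_cols_cvT_exp_sub_one_le` (transporter letters of `e^{ηA}`, skew `A`, `‖A‖ ≤ r_A`, `ηr_A ≤ 1`).

HONEST FRAMING ∕ LIMITS.  Plumbing on MODEL carriers (doubled-torus cover; FILE 130's currency); no estimate of Bałaban's.  NE2⁺ NOT PRINTED; N15 of record untouched (DISCHARGED AS CONSUMED);
counts UNMOVED (typed 28∕28); one finite 𝕋⁴ at fixed ε per index — NOT infinite volume ∕ OS ∕ mass gap ∕ Clay.  Restate-immune (no Theses import).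
-/

noncomputable section

open scoped BigOperators Matrix

namespace Summit.QuantumFields.YangMills.BalabanUVNodes.N15.Gluing

open Real NormedSpace
open Literature.MathematicalPhysics.QuantumFieldTheory.Balaban1983to89
open Literature.MathematicalPhysics.QuantumFieldTheory.Balaban1983to89.B11SectG (BlockNorm HasMaj)
open Literature.MathematicalPhysics.QuantumFieldTheory.Balaban1983to89.B11AxialTransport190 (abs_le_loc_ofBlocks loc_ofBlocks_le)
open Literature.MathematicalPhysics.QuantumFieldTheory.Balaban1983to89.B6Prop26Gluing (mulOp mulOp_apply)
open Literature.MathematicalPhysics.QuantumFieldTheory.Balaban1983to89.B6UnitTorusCarrier (unitTorusGeo)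
open Literature.MathematicalPhysics.QuantumFieldTheory.Balaban1983to89.T4EtaRateDefect (idef)
open Literature.MathematicalPhysics.QuantumFieldTheory.Balaban1983to89.T4EtaRateCoeffDefect (pull pull_apply)
open Literature.MathematicalPhysics.QuantumFieldTheory.King1986.Torus (blockOf tdistT)
open Literature.Barriers.QuantumFields (traceForm)
open Summit.QuantumFields.YangMills.BalabanUVNodes.N15.VectorPiece (bshiftEquiv tensorId tensorId_apply kingPr kingPrV kingPrV_eq)
open Summit.QuantumFields.YangMills.BalabanUVNodes.N15.MatrixSpecies (mmulOp coordMat basisConst basisConst_nonneg liftBlk liftMap)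
open Summit.QuantumFields.YangMills.BalabanUVNodes.N15.CurvedSpecies (uN_abs_coordMat_conj_sub_one_entry_le_op exp_smul_unitary_of_conjTranspose)
open Summit.QuantumFields.YangMills.BalabanUVNodes.N15.TwoGrid (qvRe qvAdjRe landauRe chiCube chiCube_kingPrV)
open Summit.QuantumFields.YangMills.BalabanUVNodes.N15.CovAvg (qvCov qvCovAdj blockOf_kingPr norm_exp_smul_sub_one_le)

variable {d : ℕ}

/-! ## §1 The fine perturbation `N_V^Q′` -/

section Objects

open scoped Matrix.Norms.L2Operator

variable {mm : Type} [Fintype mm] [DecidableEq mm] {ι : Type} [Fintype ι] [DecidableEq ι]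
variable (d) (L : ℕ) [NeZero L]

/-- ★ THE FINE AVERAGING PERTURBATION `N_V^Q′ := a·(Q′*Q′ ⊗ 1_ι − Q*_{T′}∘Q_{T′})` at the fine spacing of the cover (transporters `cvT e U′`). [cite: Balaban1985BackgroundPropagators, (3.26) p.395, (3.59)–(3.60) p.402 (shape)] -/
def cvNVq' (mv kk r : ℕ) (hL : Odd L ∧ 1 < L) (a : ℝ) (ι : Type) [Fintype ι] [DecidableEq ι] (e : Matrix mm mm ℂ ≃L[ℝ] (ι → ℝ)) (U' : Fin (d + 1) → CvX' d L mv kk r hL → Matrix mm mm ℂ) :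
    (CvX' d L mv kk r hL × ι → ℝ) →ₗ[ℝ] (CvX' d L mv kk r hL × ι → ℝ) :=
  a • (tensorId ι (qvAdjRe (cvM d L mv kk hL) (L ^ r * L ^ kk) ∘ₗ qvRe (cvM d L mv kk hL) (L ^ r * L ^ kk)) -
    qvCovAdj (cvM d L mv kk hL) (L ^ r * L ^ kk) (cvT e U') ∘ₗ qvCov (cvM d L mv kk hL) (L ^ r * L ^ kk) (cvT e U'))

variable {d L}

/-- 123's `hP′` row at `w ≡ 1` for the fine summand `N_L′ ⊗ 1 − N_V^Q′`. [folklore] -/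
theorem conj_one_cvNL'_sub_cvNVq' (mv kk r : ℕ) (hL : Odd L ∧ 1 < L) (a : ℝ) (e : Matrix mm mm ℂ ≃L[ℝ] (ι → ℝ)) (U' : Fin (d + 1) → CvX' d L mv kk r hL → Matrix mm mm ℂ) :
    mmulOp (fun _ : CvX' d L mv kk r hL => coordMat e (ContinuousLinearMap.mulLeftRight ℝ (Matrix mm mm ℂ) (1 : Matrix mm mm ℂ) (1 : Matrix mm mm ℂ)ᴴ)) ∘ₗ
        (cvNL' d L mv kk r hL a ι - cvNVq' d L mv kk r hL a ι e U') ∘ₗ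
        mmulOp (fun _ : CvX' d L mv kk r hL => (coordMat e (ContinuousLinearMap.mulLeftRight ℝ (Matrix mm mm ℂ) (1 : Matrix mm mm ℂ) (1 : Matrix mm mm ℂ)ᴴ))ᵀ) =
      cvNL' d L mv kk r hL a ι - cvNVq' d L mv kk r hL a ι e U' := by
  have h := conj_one_eq_sub_zero e (cvNL' d L mv kk r hL a ι - cvNVq' d L mv kk r hL a ι e U')
  rw [sub_zero] at h
  exact h

end Objects

/-! ## §2 Cut-offs through the prolongation, the two-carrier sandwich, the fine-norm blocking -/

section Transfer

variable {Y Y' ι : Type}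

/-- THE CUT-OFFS MOVE OUTSIDE THE DEFECT: `idef P̂ P̂ (M_{ψ∘π̂}∘N′∘M_{χ∘π̂}) (M_ψ∘N∘M_χ) = M_{ψ∘π̂} ∘ idef P̂ P̂ N′ N ∘ M_χ` for `P̂ = pull π̂`. [folklore] -/
theorem idef_sandwich_pull (πm : Y' → Y) (ψ χ : Y → ℝ) (N' : (Y' → ℝ) →ₗ[ℝ] (Y' → ℝ)) (N : (Y → ℝ) →ₗ[ℝ] (Y → ℝ)) :
    idef (pull πm) (pull πm) (mulOp (ψ ∘ πm) ∘ₗ N' ∘ₗ mulOp (χ ∘ πm)) (mulOp ψ ∘ₗ N ∘ₗ mulOp χ) = mulOp (ψ ∘ πm) ∘ₗ idef (pull πm) (pull πm) N' N ∘ₗ mulOp χ := by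
  have h1 : mulOp (χ ∘ πm) ∘ₗ pull πm = pull πm ∘ₗ mulOp χ := LinearMap.ext fun f => funext fun y' => rfl
  have h2 : pull πm ∘ₗ mulOp ψ = mulOp (ψ ∘ πm) ∘ₗ pull πm := LinearMap.ext fun f => funext fun y' => rfl
  rw [idef, idef, LinearMap.comp_assoc, LinearMap.comp_assoc, h1, ← LinearMap.comp_assoc (N ∘ₗ mulOp χ) (mulOp ψ) (pull πm), h2]
  simp only [LinearMap.comp_sub, LinearMap.sub_comp, LinearMap.comp_assoc]

variable {g : B6.Geometry} [Fintype Y] [Fintype Y']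

/-- BOUNDED DIAGONALS ON BOTH SIDES COST NOTHING, two carriers: `|ψ′| ≤ 1` on the target, `|χ| ≤ 1` on the source, `D ≤ K` (`K ≥ 0`) ⟹ `M_{ψ′}∘D∘M_χ ≤ K`. [folklore] -/
theorem hasMaj_sandwich₂_of_abs_le_one (blk : Y → g.Site) (blk' : Y' → g.Site) {D : (Y → ℝ) →ₗ[ℝ] (Y' → ℝ)} {K : g.Site → g.Site → ℝ}
    {ψ' : Y' → ℝ} {χ : Y → ℝ} (hψ : ∀ p, |ψ' p| ≤ 1) (hχ : ∀ p, |χ p| ≤ 1) (hK : ∀ y y', 0 ≤ K y y')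
    (hD : HasMaj (BlockNorm.ofBlocks g blk) (BlockNorm.ofBlocks g blk') D K) :
    HasMaj (BlockNorm.ofBlocks g blk) (BlockNorm.ofBlocks g blk') (mulOp ψ' ∘ₗ D ∘ₗ mulOp χ) K := by
  intro y' μ hμ y
  have hχμ : (BlockNorm.ofBlocks g blk).IsLoc y' (mulOp χ μ) := fun p hp => by
    change χ p * μ p = 0
    rw [hμ p hp, mul_zero]
  have hloc : (BlockNorm.ofBlocks g blk).loc y' (mulOp χ μ) ≤ (BlockNorm.ofBlocks g blk).loc y' μ :=
    loc_ofBlocks_le blk _ ((BlockNorm.ofBlocks g blk).loc_nonneg y' μ) fun p hp => by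
      rw [mulOp_apply, abs_mul]
      exact (mul_le_of_le_one_left (abs_nonneg _) (hχ p)).trans (abs_le_loc_ofBlocks blk μ hp)
  refine loc_ofBlocks_le blk' _ (mul_nonneg (hK y y') ((BlockNorm.ofBlocks g blk).loc_nonneg y' μ)) fun p hp => ?_
  rw [LinearMap.comp_apply, LinearMap.comp_apply, mulOp_apply, abs_mul]
  calc |ψ' p| * |D (mulOp χ μ) p| ≤ 1 * |D (mulOp χ μ) p| := mul_le_mul_of_nonneg_right (hψ p) (abs_nonneg _)
    _ ≤ K y y' * (BlockNorm.ofBlocks g blk).loc y' (mulOp χ μ) := by rw [one_mul]; exact (abs_le_loc_ofBlocks blk' _ hp).trans (hD y' _ hχμ y)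
    _ ≤ K y y' * (BlockNorm.ofBlocks g blk).loc y' μ := mul_le_mul_of_nonneg_left hloc (hK y y')

variable {L : ℕ} [NeZero L]

/-- THE FINE NORM OF FILE 123 IS THE FINE UNIT-BLOCK NORM: `liftBlk (B′) ι = liftBlk (cvBlk∘π̂) ι` (`B(πx′) = B′(x′)`, n15-c∕184a `blockOf_kingPr`). [cite: King1986, p.664 («x′ ∈ B^n(x)»)] -/
theorem liftBlk_blockOf_fine_eq (mv kk r : ℕ) (hL : Odd L ∧ 1 < L) :
    liftBlk (fun b : CvX' d L mv kk r hL => blockOf (L ^ r * L ^ kk) (cvM d L mv kk hL) b.1) ι = liftBlk (cvBlk d L mv kk hL ∘ kingPrV L kk r (cvM d L mv kk hL)) ι := by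
  funext p
  simp only [liftBlk, Function.comp_apply, kingPrV_eq]
  exact (blockOf_kingPr (cvM d L mv kk hL) L kk r p.1.1).symm

/-- The fine input cut factors through the pairing: `χ′_k = χ_k∘π̂` on the coloured carrier. [folklore] -/
theorem cvChi'_eq_comp (mv kk r : ℕ) (hL : Odd L ∧ 1 < L) (k : Fin (d + 1) → ZMod (2 * L)) :
    (fun p : CvX' d L mv kk r hL × ι => cvChi' d L mv kk r hL k p.1) = (fun p : CvX d L mv kk hL × ι => cvChi d L mv kk hL k p.1) ∘ liftMap (kingPrV L kk r (cvM d L mv kk hL)) ι := by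
  funext p
  simp only [Function.comp_apply]
  exact (chiCube_kingPrV L kk r _ _ p.1).symm

/-- The fine plateau factors through the pairing: `ψ′_k = ψ_k∘π̂`. [folklore] -/
theorem cvPsi'_eq_comp (mv kk r : ℕ) (hL : Odd L ∧ 1 < L) (k : Fin (d + 1) → ZMod (2 * L)) :
    (fun p : CvX' d L mv kk r hL × ι => cvPsi' d L mv kk r hL k p.1) = (fun p : CvX d L mv kk hL × ι => cvPsi d L mv kk hL k p.1) ∘ liftMap (kingPrV L kk r (cvM d L mv kk hL)) ι := by
  funext p
  simp only [Function.comp_apply]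
  exact (chiCube_kingPrV L kk r _ _ p.1).symm

/-- … and so does `1 − ψ′_k`. [folklore] -/
theorem one_sub_cvPsi'_eq_comp (mv kk r : ℕ) (hL : Odd L ∧ 1 < L) (k : Fin (d + 1) → ZMod (2 * L)) :
    (fun p : CvX' d L mv kk r hL × ι => (1 - cvPsi' d L mv kk r hL k) p.1) = (fun p : CvX d L mv kk hL × ι => (1 - cvPsi d L mv kk hL k) p.1) ∘ liftMap (kingPrV L kk r (cvM d L mv kk hL)) ι := by
  funext p
  simp only [Function.comp_apply, Pi.sub_apply, Pi.one_apply]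
  exact congrArg (fun t : ℝ => 1 - t) (chiCube_kingPrV L kk r _ _ p.1).symm

end Transfer

/-! ## §3 The transporter letters of `e^{ηA}` for a skew field -/

section TransporterLetters

open scoped Matrix.Norms.L2Operator

variable {mm : Type} [Fintype mm] [DecidableEq mm] {ι : Type} [Fintype ι] [DecidableEq ι] (e : Matrix mm mm ℂ ≃L[ℝ] (ι → ℝ)) {X : Type}

/-- The entry letter: `|(coordMat e Ad_{e^{ηA_μ(p)}} − 1)_{ij}| ≤ κ_e·2√m·(√m·(e^{ηr_A} − 1))` for skew `A` with `‖A‖ ≤ r_A`, `η ≥ 0`. [cite: Balaban1985BackgroundPropagators, (3.35) p.396, (3.50) p.400 (shapes)] -/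
theorem sf_abs_cvT_exp_sub_one_entry_le {η rA : ℝ} (hη : 0 ≤ η) {A : Fin (d + 1) → X → Matrix mm mm ℂ} (hAs : ∀ μ x, (A μ x)ᴴ = -A μ x) (hA : ∀ μ x, ‖A μ x‖ ≤ rA)
    (μ : Fin (d + 1)) (p : X) (i j : ι) :
    |(cvT e (fun μ x => exp (η • A μ x)) μ p - 1) i j| ≤
      @basisConst ι _ (Matrix mm mm ℂ) Matrix.frobeniusNormedAddCommGroup Matrix.frobeniusNormedSpace e * (2 * Real.sqrt (Fintype.card mm)) * (Real.sqrt (Fintype.card mm) * (Real.exp (η * rA) - 1)) := by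
  have hU : (exp (η • A μ p))ᴴ * exp (η • A μ p) = 1 := exp_smul_unitary_of_conjTranspose (hAs μ p) η
  refine (uN_abs_coordMat_conj_sub_one_entry_le_op e hU i j).trans ?_
  have hκ := @basisConst_nonneg ι _ (Matrix mm mm ℂ) Matrix.frobeniusNormedAddCommGroup Matrix.frobeniusNormedSpace e
  have h1 := norm_exp_smul_sub_one_le (Z := A μ p) hη (hA μ p)
  gcongr

/-- ★ ROWS of `cvT e (e^{ηA}) − 1` ≤ `|ι|·κ_e·2√m·(√m·(e^{ηr_A} − 1))`. [cite: Balaban1985BackgroundPropagators, (3.35) p.396, (3.50) p.400 (shapes)] -/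
theorem sf_rows_cvT_exp_sub_one_le {η rA : ℝ} (hη : 0 ≤ η) {A : Fin (d + 1) → X → Matrix mm mm ℂ} (hAs : ∀ μ x, (A μ x)ᴴ = -A μ x) (hA : ∀ μ x, ‖A μ x‖ ≤ rA)
    (μ : Fin (d + 1)) (p : X) (i : ι) :
    ∑ j, |(cvT e (fun μ x => exp (η • A μ x)) μ p - 1) i j| ≤
      Fintype.card ι * (@basisConst ι _ (Matrix mm mm ℂ) Matrix.frobeniusNormedAddCommGroup Matrix.frobeniusNormedSpace e * (2 * Real.sqrt (Fintype.card mm)) * (Real.sqrt (Fintype.card mm) * (Real.exp (η * rA) - 1))) := by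
  calc _ ≤ ∑ _j : ι, @basisConst ι _ (Matrix mm mm ℂ) Matrix.frobeniusNormedAddCommGroup Matrix.frobeniusNormedSpace e * (2 * Real.sqrt (Fintype.card mm)) * (Real.sqrt (Fintype.card mm) * (Real.exp (η * rA) - 1)) :=
        Finset.sum_le_sum fun j _ => sf_abs_cvT_exp_sub_one_entry_le e hη hAs hA μ p i j
    _ = _ := by rw [Finset.sum_const, Finset.card_univ, nsmul_eq_mul]

/-- ★ COLUMNS of `cvT e (e^{ηA}) − 1` ≤ `|ι|·κ_e·2√m·(√m·(e^{ηr_A} − 1))`. [cite: Balaban1985BackgroundPropagators, (3.35) p.396, (3.50) p.400 (shapes)] -/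
theorem sf_cols_cvT_exp_sub_one_le {η rA : ℝ} (hη : 0 ≤ η) {A : Fin (d + 1) → X → Matrix mm mm ℂ} (hAs : ∀ μ x, (A μ x)ᴴ = -A μ x) (hA : ∀ μ x, ‖A μ x‖ ≤ rA)
    (μ : Fin (d + 1)) (p : X) (j : ι) :
    ∑ i, |(cvT e (fun μ x => exp (η • A μ x)) μ p - 1) i j| ≤
      Fintype.card ι * (@basisConst ι _ (Matrix mm mm ℂ) Matrix.frobeniusNormedAddCommGroup Matrix.frobeniusNormedSpace e * (2 * Real.sqrt (Fintype.card mm)) * (Real.sqrt (Fintype.card mm) * (Real.exp (η * rA) - 1))) := by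
  calc _ ≤ ∑ _i : ι, @basisConst ι _ (Matrix mm mm ℂ) Matrix.frobeniusNormedAddCommGroup Matrix.frobeniusNormedSpace e * (2 * Real.sqrt (Fintype.card mm)) * (Real.sqrt (Fintype.card mm) * (Real.exp (η * rA) - 1)) :=
        Finset.sum_le_sum fun i _ => sf_abs_cvT_exp_sub_one_entry_le e hη hAs hA μ p i j
    _ = _ := by rw [Finset.sum_const, Finset.card_univ, nsmul_eq_mul]

end TransporterLetters

end Summit.QuantumFields.YangMills.BalabanUVNodes.N15.Gluing

end
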